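import Summits.PneNP.PneNP.Theorems.ConvexRankGatesConvexGateBlindExactLiftingTriangleLineCover

/-!
# Triangle instance — PLANE-LOCAL ("two-tier") factorisations reduce exactly to a `t × t` dictionary problem

Support file for crux `ConvexGateBlind` (stmt-PneNP-10680), line `xor-door-perfect-completeness`, open stub
`stub_exactLifting` (prover seat 3, session 15).  Instance of record: the triangle matrix
`M_t[x,(a,b,d)] = monoCount x (a,b,d) = 1 + 2·[x₁ a = x₂ b = x₃ d]` (`…TriangleLineCover`); question of record:
`rk₊(M_t − εJ)` as `ε → 0⁺` (`3t²` at `ε = 0` by the junta lines, `≥ t³/2` at `ε = 1`).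

THE SUB-MODEL.  Fix the direction `2` (middle block).  A non-negative factorisation of `M_t − εJ` is
PLANE-LOCAL (of direction 2) if every atom is either constant along the direction-2 lines `(a,·,d)` (e.g. the
`t²` direction-2 junta lines of the line factorisation, or any non-negative `b`-independent term) or supported in
a single plane `{b = b₀}`.  Row by row this is the normal form (`PlaneFact`)
`M_t[x,(a,b,d)] − ε = C x a d + ∑_l U x b l · W b l a d` with `C, U, W ≥ 0`: a `b`-independent part plus, in
each plane `b`, a non-negative combination of that plane's own dictionary `W b : Fin D → (t × t matrices)`.
It contains the trivial column factorisation (`D = t²`, `W b` = the matrix units) and the line factorisation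
(`ε = 0`, `D = 2t`, `W b` = the in-plane lines); its size is `t · D` plane atoms (+ whatever carries `C`).

THE REDUCTION (both directions, elementary and exact).
* `dictSolves_of_planeFact`: a plane-local factorisation with `D` atoms per plane yields, for ANY two planes
  `b₀ ≠ b₁`, a dictionary of `2D` non-negative `t × t` matrices solving the DICTIONARY PROBLEM `(D_ε)`
  (`DictSolves`): for every pair of vertex subsets `P, S ⊆ [t]` there is a common background
  `E ∈ [0, 1−ε]^{t×t}` such that BOTH `2·𝟙_{P×S} + E` and `2·𝟙_{Pᶜ×Sᶜ} + E` are non-negative combinations of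
  the dictionary.  (Choose the colouring `x₁ = ¬P, x₃ = ¬S, x₂ b₀ = false, x₂ b₁ = true`; the `b`-independent
  part is `≤ 1 − ε` because `(a,b₀,d)` and `(a,b₁,d)` are never both monochromatic.)
* `planeRow_of_dictSolves`: conversely a dictionary `H` solving `(D_ε)` gives a plane-local factorisation of
  `M_t − εJ` with the SAME dictionary in every plane (`t·|H|` plane atoms plus the `t²` direction-2 lines).
So the plane-local strict rank of `M_t` is `Θ(t · m_ε(t))`, `m_ε(t)` := the least size of a dictionary solving
`(D_ε)`; `m_ε(t) ≤ t²` (units) for every `ε < 1`, and `m_0(t) ≤ 2t` (lines, `dictSolvesL_lines`).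
* `coupled_hooks` (the ε-UNIFORM necessary condition, lines written separately, `DictSolvesL`): writing
  `X₀ = ∑ c₀ᵢ Hᵢ`, `X₁ = ∑ c₁ᵢ Hᵢ` for the non-line parts of the two representations, for all `a ∈ P, d ∈ S,
  a' ∉ P, d' ∉ S`:  `X₀(a,d) ≥ 2ε + X₀(a,d') + X₀(a',d) + X₁(a,d)` and
  `X₁(a',d') ≥ 2ε + X₁(a',d) + X₁(a,d') + X₀(a',d')`.  Dividing by `ε` this is a SCALE-FREE condition on the
  cone of the dictionary that does not degrade as `ε → 0⁺` ("coupled hooks"); with the empty dictionary it gives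
  `ε ≤ 0` (`eps_nonpos_of_lines`): in-plane lines alone stop exactly at the strict side, for every `t ≥ 2`.
Whether `m_ε(t)` is `Θ(t²)` uniformly in `ε > 0` (⇔ a cubic ε-uniform bound for plane-local factorisations) or
`O(t)` for `ε = ε(t) → 0` (⇒ `rk₊₊(M_t) = O(t²)`, killing the instance) is decided entirely inside `(D_ε)`;
memo `PLANELOCAL-seat3.md` on the item records the computations (`m` for `t ≤ 5`).

Nothing here is cited; everything is elementary bookkeeping over `Finset.sum`.
-/

set_option linter.dupNamespace false -- `Summit.PneNP.PneNP.…`: summit = sub-problem (D-0017)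

namespace Summit.PneNP.PneNP.Theorems.XorDoor.TriLine

open Finset

noncomputable section

variable {t : ℕ}

/-! ## The dictionary problem -/

/-- The box of colour `c`: `2` on `{a : P a = c} × {d : S d = c}`, `0` elsewhere (the in-plane picture of
`M_t − εJ − (1−ε)J` in a plane whose middle vertex has colour `c`, for the colourings `x₁ = ¬P`, `x₃ = ¬S`). -/
def box (P S : Fin t → Bool) (c : Bool) (a d : Fin t) : ℝ := if P a = c ∧ S d = c then 2 else 0

/-- box values are `0` or `2` -/
lemma box_nonneg (P S : Fin t → Bool) (c : Bool) (a d : Fin t) : 0 ≤ box P S c a d := by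
  unfold box; split_ifs <;> norm_num

/-- The per-plane DICTIONARY PROBLEM `(D_ε)` for a finite dictionary `H` of `t × t` real matrices: every pair of
vertex subsets `(P, S)` admits a common background `E ∈ [0, 1 − ε]` such that both `2·𝟙_{P×S} + E` and
`2·𝟙_{Pᶜ×Sᶜ} + E` are non-negative combinations of the dictionary. -/
def DictSolves (ε : ℝ) {ι : Type} [Fintype ι] (H : ι → Fin t → Fin t → ℝ) : Prop :=
  ∀ P S : Fin t → Bool, ∃ (E : Fin t → Fin t → ℝ) (c₀ c₁ : ι → ℝ),
    (∀ a d, 0 ≤ E a d) ∧ (∀ a d, E a d ≤ 1 - ε) ∧ (∀ i, 0 ≤ c₀ i) ∧ (∀ i, 0 ≤ c₁ i) ∧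
    (∀ a d, ∑ i, c₀ i * H i a d = box P S true a d + E a d) ∧
    (∀ a d, ∑ i, c₁ i * H i a d = box P S false a d + E a d)

/-- The same problem with the `2t` in-plane lines (rows `f`, columns `g`) written separately from the dictionary,
so that necessary conditions can be stated on the non-line part alone. -/
def DictSolvesL (ε : ℝ) {ι : Type} [Fintype ι] (H : ι → Fin t → Fin t → ℝ) : Prop :=
  ∀ P S : Fin t → Bool, ∃ (E : Fin t → Fin t → ℝ) (c₀ c₁ : ι → ℝ) (f₀ g₀ f₁ g₁ : Fin t → ℝ),
    (∀ a d, 0 ≤ E a d) ∧ (∀ a d, E a d ≤ 1 - ε) ∧ (∀ i, 0 ≤ c₀ i) ∧ (∀ i, 0 ≤ c₁ i) ∧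
    (∀ a, 0 ≤ f₀ a) ∧ (∀ d, 0 ≤ g₀ d) ∧ (∀ a, 0 ≤ f₁ a) ∧ (∀ d, 0 ≤ g₁ d) ∧
    (∀ a d, ∑ i, c₀ i * H i a d + f₀ a + g₀ d = box P S true a d + E a d) ∧
    (∀ a d, ∑ i, c₁ i * H i a d + f₁ a + g₁ d = box P S false a d + E a d)

/-- a dictionary solving `(D_ε)` solves the version with free lines (take no lines) -/
lemma dictSolvesL_of_dictSolves {ε : ℝ} {ι : Type} [Fintype ι] {H : ι → Fin t → Fin t → ℝ}
    (h : DictSolves ε H) : DictSolvesL ε H := by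
  intro P S
  obtain ⟨E, c₀, c₁, hE0, hE1, hc₀, hc₁, h₀, h₁⟩ := h P S
  refine ⟨E, c₀, c₁, 0, 0, 0, 0, hE0, hE1, hc₀, hc₁, fun _ => le_rfl, fun _ => le_rfl, fun _ => le_rfl,
    fun _ => le_rfl, ?_, ?_⟩
  · intro a d; simpa using h₀ a d
  · intro a d; simpa using h₁ a d

/-! ## Plane-local factorisations of the shifted triangle matrix -/

/-- A PLANE-LOCAL (direction-2) non-negative factorisation of `M_t − εJ` with `D` atoms per plane:
`M_t[x,(a,b,d)] − ε = C x a d + ∑_l U x b l · W b l a d`, the `b`-independent part `C ≥ 0` collecting the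
direction-2 lines (and any other non-negative term constant along them), `W b l ≥ 0` the `l`-th atom of the
plane `b`, `U ≥ 0` the coefficients. -/
def PlaneFact (ε : ℝ) {D : ℕ} (C : Col t → Fin t → Fin t → ℝ) (U : Col t → Fin t → Fin D → ℝ)
    (W : Fin t → Fin D → Fin t → Fin t → ℝ) : Prop :=
  (∀ x a d, 0 ≤ C x a d) ∧ (∀ x b l, 0 ≤ U x b l) ∧ (∀ b l a d, 0 ≤ W b l a d) ∧
    ∀ (x : Col t) (a b d : Fin t), (monoCount x (a, b, d) : ℝ) - ε = C x a d + ∑ l, U x b l * W b l a d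

/-- the triangle matrix in closed form: `3` on monochromatic triangles, `1` elsewhere (a local copy, with the
triangle given by its three vertices, of `monoCount_eq_ite` of `…TriangleMass`) -/
private lemma monoCount_eq_ite_abd (x : Col t) (a b d : Fin t) :
    (monoCount x (a, b, d) : ℝ) = if IsMono x a b d then 3 else 1 := by
  split_ifs with h
  · rw [monoCount_of_isMono h]; norm_num
  · rw [monoCount_of_not_isMono h]; norm_num

/-- The colouring attached to a pair of vertex sets and two distinguished planes: `x₁ = ¬P`, `x₃ = ¬S`,
`x₂ b = [b ≠ b₀]`. -/
def colOf (P S : Fin t → Bool) (b₀ : Fin t) : Col t :=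
  (fun a => !(P a), fun b => !(decide (b = b₀)), fun d => !(S d))

/-- in the plane `b₀` the monochromatic triangles of `colOf P S b₀` are exactly `P × S` -/
lemma isMono_colOf_self (P S : Fin t → Bool) (b₀ : Fin t) (a d : Fin t) :
    IsMono (colOf P S b₀) a b₀ d ↔ (P a = true ∧ S d = true) := by
  unfold IsMono colOf
  simp only [decide_true, Bool.not_true]
  rcases Bool.eq_false_or_eq_true (P a) with h1 | h1 <;>
    rcases Bool.eq_false_or_eq_true (S d) with h3 | h3 <;> simp [h1, h3]

/-- in any other plane `b₁ ≠ b₀` they are exactly `Pᶜ × Sᶜ` -/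
lemma isMono_colOf_other (P S : Fin t → Bool) {b₀ b₁ : Fin t} (hb : b₁ ≠ b₀) (a d : Fin t) :
    IsMono (colOf P S b₀) a b₁ d ↔ (P a = false ∧ S d = false) := by
  unfold IsMono colOf
  simp only [hb, decide_false, Bool.not_false]
  rcases Bool.eq_false_or_eq_true (P a) with h1 | h1 <;>
    rcases Bool.eq_false_or_eq_true (S d) with h3 | h3 <;> simp [h1, h3]

/-- **Reduction, factorisation ⇒ dictionary.**  A plane-local factorisation of `M_t − εJ` with `D` atoms per
plane yields, for any two distinct planes `b₀, b₁`, a dictionary of `2D` matrices (the atoms of the two planes)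
solving `(D_ε)`. -/
theorem dictSolves_of_planeFact {ε : ℝ} {D : ℕ} {C : Col t → Fin t → Fin t → ℝ}
    {U : Col t → Fin t → Fin D → ℝ} {W : Fin t → Fin D → Fin t → Fin t → ℝ} (hF : PlaneFact ε C U W)
    {b₀ b₁ : Fin t} (hb : b₀ ≠ b₁) :
    DictSolves ε (Sum.elim (W b₀) (W b₁) : Fin D ⊕ Fin D → Fin t → Fin t → ℝ) := by
  obtain ⟨hC, hU, hW, hfact⟩ := hF
  intro P S
  set x : Col t := colOf P S b₀ with hx
  refine ⟨fun a d => 1 - ε - C x a d, Sum.elim (U x b₀) (fun _ => 0), Sum.elim (fun _ => 0) (U x b₁),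
    ?_, ?_, ?_, ?_, ?_, ?_⟩
  · -- `E ≥ 0`: the `b`-independent part is at most `1 − ε`, read off at a non-monochromatic plane
    intro a d
    have h0 := hfact x a b₀ d
    have h1 := hfact x a b₁ d
    have hs0 : 0 ≤ ∑ l, U x b₀ l * W b₀ l a d :=
      Finset.sum_nonneg fun l _ => mul_nonneg (hU x b₀ l) (hW b₀ l a d)
    have hs1 : 0 ≤ ∑ l, U x b₁ l * W b₁ l a d :=
      Finset.sum_nonneg fun l _ => mul_nonneg (hU x b₁ l) (hW b₁ l a d)
    rw [monoCount_eq_ite_abd] at h0 h1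
    by_cases hm : IsMono x a b₀ d
    · -- then the plane `b₁` is not monochromatic at `(a, d)`
      have hm1 : ¬ IsMono x a b₁ d := by
        rw [hx, isMono_colOf_other P S hb.symm]
        rw [hx, isMono_colOf_self] at hm
        rcases hm with ⟨hPa, _⟩
        rintro ⟨hPa', _⟩
        rw [hPa] at hPa'
        exact Bool.noConfusion hPa'
      rw [if_neg hm1] at h1
      linarith
    · rw [if_neg hm] at h0
      linarith
  · intro a d
    have := hC x a d
    show 1 - ε - C x a d ≤ 1 - ε
    linarith
  · rintro (l | l)
    · exact hU x b₀ l
    · exact le_rfl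
  · rintro (l | l)
    · exact le_rfl
    · exact hU x b₁ l
  · intro a d
    have h0 := hfact x a b₀ d
    rw [monoCount_eq_ite_abd] at h0
    simp only [Fintype.sum_sum_type, Sum.elim_inl, Sum.elim_inr, zero_mul, Finset.sum_const_zero, add_zero]
    have hiff : IsMono x a b₀ d ↔ (P a = true ∧ S d = true) := by
      rw [hx]; exact isMono_colOf_self P S b₀ a d
    unfold box
    by_cases hm : IsMono x a b₀ d
    · rw [if_pos hm] at h0; rw [if_pos (hiff.mp hm)]; linarith
    · rw [if_neg hm] at h0; rw [if_neg (fun h => hm (hiff.mpr h))]; linarith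
  · intro a d
    have h1 := hfact x a b₁ d
    rw [monoCount_eq_ite_abd] at h1
    simp only [Fintype.sum_sum_type, Sum.elim_inl, Sum.elim_inr, zero_mul, Finset.sum_const_zero, zero_add]
    have hiff : IsMono x a b₁ d ↔ (P a = false ∧ S d = false) := by
      rw [hx]; exact isMono_colOf_other P S hb.symm a d
    unfold box
    by_cases hm : IsMono x a b₁ d
    · rw [if_pos hm] at h1; rw [if_pos (hiff.mp hm)]; linarith
    · rw [if_neg hm] at h1; rw [if_neg (fun h => hm (hiff.mpr h))]; linarith

/-- **Reduction, dictionary ⇒ factorisation.**  A dictionary `H` solving `(D_ε)` gives, row by row, a plane-local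
factorisation of `M_t − εJ` using the SAME dictionary in every plane plus a non-negative `b`-independent part
(carried by the `t²` direction-2 lines): `t·|H|` plane atoms. -/
theorem planeRow_of_dictSolves {ε : ℝ} {ι : Type} [Fintype ι] {H : ι → Fin t → Fin t → ℝ}
    (h : DictSolves ε H) (x : Col t) :
    ∃ (C : Fin t → Fin t → ℝ) (U : Fin t → ι → ℝ), (∀ a d, 0 ≤ C a d) ∧ (∀ b i, 0 ≤ U b i) ∧
      ∀ a b d, (monoCount x (a, b, d) : ℝ) - ε = C a d + ∑ i, U b i * H i a d := by
  -- the pair of vertex sets seen by the row `x`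
  set P : Fin t → Bool := fun a => !(x.1 a) with hP
  set S : Fin t → Bool := fun d => !(x.2.2 d) with hS
  obtain ⟨E, c₀, c₁, hE0, hE1, hc₀, hc₁, h₀, h₁⟩ := h P S
  refine ⟨fun a d => 1 - ε - E a d, fun b i => if x.2.1 b = false then c₀ i else c₁ i, ?_, ?_, ?_⟩
  · intro a d; have := hE1 a d; show 0 ≤ 1 - ε - E a d; linarith
  · intro b i; dsimp only; split_ifs
    · exact hc₀ i
    · exact hc₁ i
  · intro a b d
    rw [monoCount_eq_ite_abd]
    rcases Bool.eq_false_or_eq_true (x.2.1 b) with hb | hb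
    · -- middle colour `true`: monochromatic iff `P a = false ∧ S d = false`
      have hm : IsMono x a b d ↔ (P a = false ∧ S d = false) := by
        unfold IsMono; rw [hP, hS, hb]
        rcases Bool.eq_false_or_eq_true (x.1 a) with h1 | h1 <;>
          rcases Bool.eq_false_or_eq_true (x.2.2 d) with h3 | h3 <;> simp [h1, h3]
      simp only [hb, Bool.true_eq_false, ↓reduceIte]
      rw [h₁ a d]
      unfold box
      by_cases hmono : IsMono x a b d
      · rw [if_pos (hm.mp hmono), if_pos hmono]; ring
      · rw [if_neg (fun h => hmono (hm.mpr h)), if_neg hmono]; ring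
    · have hm : IsMono x a b d ↔ (P a = true ∧ S d = true) := by
        unfold IsMono; rw [hP, hS, hb]
        rcases Bool.eq_false_or_eq_true (x.1 a) with h1 | h1 <;>
          rcases Bool.eq_false_or_eq_true (x.2.2 d) with h3 | h3 <;> simp [h1, h3]
      simp only [hb, ↓reduceIte]
      rw [h₀ a d]
      unfold box
      by_cases hmono : IsMono x a b d
      · rw [if_pos (hm.mp hmono), if_pos hmono]; ring
      · rw [if_neg (fun h => hmono (hm.mpr h)), if_neg hmono]; ring

/-! ## The ε-uniform necessary condition: coupled hooks -/

/-- **Coupled hooks, colour `true` side.**  In any solution of `(D_ε)` at `(P, S)` with the lines written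
separately, the non-line part `X₀ = ∑ c₀ᵢ Hᵢ` of the first representation dominates, at every entry of `P × S`,
the sum of: `2ε`, its own entries at the two hook corners `(a, d')`, `(a', d)` outside the box, and the OTHER
non-line part `X₁` at the same entry.  (The lines cancel in every hook; `E ≤ 1 − ε` off the box and
`E = X₁ + lines ≥ X₁` on it.) -/
theorem coupled_hook_true {ε : ℝ} {ι : Type} [Fintype ι] {H : ι → Fin t → Fin t → ℝ}
    (hH : ∀ i a d, 0 ≤ H i a d) {P S : Fin t → Bool} {E : Fin t → Fin t → ℝ} {c₀ c₁ : ι → ℝ}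
    {f₀ g₀ f₁ g₁ : Fin t → ℝ} (hE1 : ∀ a d, E a d ≤ 1 - ε) (hc₁ : ∀ i, 0 ≤ c₁ i)
    (hf₀ : ∀ a, 0 ≤ f₀ a) (hg₀ : ∀ d, 0 ≤ g₀ d) (hf₁ : ∀ a, 0 ≤ f₁ a) (hg₁ : ∀ d, 0 ≤ g₁ d)
    (h₀ : ∀ a d, ∑ i, c₀ i * H i a d + f₀ a + g₀ d = box P S true a d + E a d)
    (h₁ : ∀ a d, ∑ i, c₁ i * H i a d + f₁ a + g₁ d = box P S false a d + E a d)
    {a d a' d' : Fin t} (ha : P a = true) (hd : S d = true) (ha' : P a' = false) (hd' : S d' = false) :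
    2 * ε + (∑ i, c₀ i * H i a d') + (∑ i, c₀ i * H i a' d) + (∑ i, c₁ i * H i a d)
      ≤ ∑ i, c₀ i * H i a d := by
  have e1 := h₀ a d
  have e2 := h₀ a d'
  have e3 := h₀ a' d
  have e4 := h₁ a d
  have hb1 : box P S true a d = 2 := by unfold box; rw [if_pos ⟨ha, hd⟩]
  have hb2 : box P S true a d' = 0 := by
    unfold box; rw [if_neg]; rintro ⟨_, h⟩; rw [hd'] at h; exact Bool.noConfusion h
  have hb3 : box P S true a' d = 0 := by
    unfold box; rw [if_neg]; rintro ⟨h, _⟩; rw [ha'] at h; exact Bool.noConfusion h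
  have hb4 : box P S false a d = 0 := by
    unfold box; rw [if_neg]; rintro ⟨h, _⟩; rw [ha] at h; exact Bool.noConfusion h
  rw [hb1] at e1; rw [hb2] at e2; rw [hb3] at e3; rw [hb4] at e4
  have hX1 : 0 ≤ ∑ i, c₁ i * H i a d := Finset.sum_nonneg fun i _ => mul_nonneg (hc₁ i) (hH i a d)
  have := hE1 a d'; have := hE1 a' d
  have := hf₀ a; have := hg₀ d; have := hf₀ a'; have := hg₀ d'; have := hf₁ a; have := hg₁ d
  linarith

/-- **Coupled hooks, colour `false` side** (the mirror statement for `X₁` on `Pᶜ × Sᶜ`). -/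
theorem coupled_hook_false {ε : ℝ} {ι : Type} [Fintype ι] {H : ι → Fin t → Fin t → ℝ}
    (hH : ∀ i a d, 0 ≤ H i a d) {P S : Fin t → Bool} {E : Fin t → Fin t → ℝ} {c₀ c₁ : ι → ℝ}
    {f₀ g₀ f₁ g₁ : Fin t → ℝ} (hE1 : ∀ a d, E a d ≤ 1 - ε) (hc₀ : ∀ i, 0 ≤ c₀ i)
    (hf₀ : ∀ a, 0 ≤ f₀ a) (hg₀ : ∀ d, 0 ≤ g₀ d) (hf₁ : ∀ a, 0 ≤ f₁ a) (hg₁ : ∀ d, 0 ≤ g₁ d)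
    (h₀ : ∀ a d, ∑ i, c₀ i * H i a d + f₀ a + g₀ d = box P S true a d + E a d)
    (h₁ : ∀ a d, ∑ i, c₁ i * H i a d + f₁ a + g₁ d = box P S false a d + E a d)
    {a d a' d' : Fin t} (ha : P a = true) (hd : S d = true) (ha' : P a' = false) (hd' : S d' = false) :
    2 * ε + (∑ i, c₁ i * H i a' d) + (∑ i, c₁ i * H i a d') + (∑ i, c₀ i * H i a' d')
      ≤ ∑ i, c₁ i * H i a' d' := by
  have e1 := h₁ a' d'
  have e2 := h₁ a' d
  have e3 := h₁ a d'
  have e4 := h₀ a' d'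
  have hb1 : box P S false a' d' = 2 := by unfold box; rw [if_pos ⟨ha', hd'⟩]
  have hb2 : box P S false a' d = 0 := by
    unfold box; rw [if_neg]; rintro ⟨_, h⟩; rw [hd] at h; exact Bool.noConfusion h
  have hb3 : box P S false a d' = 0 := by
    unfold box; rw [if_neg]; rintro ⟨h, _⟩; rw [ha] at h; exact Bool.noConfusion h
  have hb4 : box P S true a' d' = 0 := by
    unfold box; rw [if_neg]; rintro ⟨h, _⟩; rw [ha'] at h; exact Bool.noConfusion h
  rw [hb1] at e1; rw [hb2] at e2; rw [hb3] at e3; rw [hb4] at e4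
  have hX0 : 0 ≤ ∑ i, c₀ i * H i a' d' := Finset.sum_nonneg fun i _ => mul_nonneg (hc₀ i) (hH i a' d')
  have := hE1 a' d; have := hE1 a d'
  have := hf₁ a'; have := hg₁ d'; have := hf₁ a; have := hg₁ d; have := hf₀ a'; have := hg₀ d'
  linarith

/-- **Lines stop at the strict side.**  If the EMPTY dictionary solves `(D_ε)` with free lines (i.e. the in-plane
lines alone represent both boxes over a common background) and `t ≥ 2`, then `ε ≤ 0`. -/
theorem eps_nonpos_of_lines {ε : ℝ} (ht : 2 ≤ t)
    (h : DictSolvesL ε (fun (_ : Fin 0) (_ : Fin t) (_ : Fin t) => (0 : ℝ))) : ε ≤ 0 := by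
  -- the pair `P = S = {vertex 0}` has all four blocks non-empty
  have h0 : 0 < t := by omega
  have h1 : 1 < t := by omega
  set P : Fin t → Bool := fun a => decide (a = ⟨0, h0⟩) with hP
  obtain ⟨E, c₀, c₁, f₀, g₀, f₁, g₁, _, hE1, _, hc₁, hf₀, hg₀, hf₁, hg₁, e₀, e₁⟩ := h P P
  have hPa : P ⟨0, h0⟩ = true := by rw [hP]; simp
  have hPa' : P ⟨1, h1⟩ = false := by
    rw [hP]; simp only [decide_eq_false_iff_not]
    intro hh; have := congrArg Fin.val hh; simp at this
  have key := coupled_hook_true (H := fun (_ : Fin 0) (_ : Fin t) (_ : Fin t) => (0 : ℝ))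
    (fun _ _ _ => le_rfl) hE1 hc₁ hf₀ hg₀ hf₁ hg₁ e₀ e₁ hPa hPa hPa' hPa'
  simp only [Finset.univ_eq_empty, Finset.sum_empty, add_zero] at key
  linarith

/-- **The lines solve `(D_0)`.**  With the empty dictionary and `ε = 0` the in-plane lines do represent both boxes
over the common background `E = 𝟙[P a ≠ S d]` — the in-plane shadow of the `3t²`-line factorisation of `M_t`;
so `eps_nonpos_of_lines` is sharp. -/
theorem dictSolvesL_lines : DictSolvesL (t := t) 0 (fun (_ : Fin 0) (_ : Fin t) (_ : Fin t) => (0 : ℝ)) := by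
  intro P S
  refine ⟨fun a d => if P a = S d then 0 else 1, fun _ => 0, fun _ => 0,
    fun a => if P a = true then 1 else 0, fun d => if S d = true then 1 else 0,
    fun a => if P a = false then 1 else 0, fun d => if S d = false then 1 else 0,
    ?_, ?_, fun _ => le_rfl, fun _ => le_rfl, ?_, ?_, ?_, ?_, ?_, ?_⟩
  · intro a d; dsimp only; split_ifs <;> norm_num
  · intro a d; dsimp only; split_ifs <;> norm_num
  · intro a; dsimp only; split_ifs <;> norm_num
  · intro d; dsimp only; split_ifs <;> norm_num
  · intro a; dsimp only; split_ifs <;> norm_num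
  · intro d; dsimp only; split_ifs <;> norm_num
  · intro a d
    simp only [Finset.univ_eq_empty, Finset.sum_empty, zero_add]
    unfold box
    cases hPa : P a <;> cases hSd : S d <;> norm_num [hPa, hSd]
  · intro a d
    simp only [Finset.univ_eq_empty, Finset.sum_empty, zero_add]
    unfold box
    cases hPa : P a <;> cases hSd : S d <;> norm_num [hPa, hSd]

/-- Registered form (crux stmt-PneNP-10680, sub-goal `triangle_planeLocal_dict`): plane-local factorisations of
the shifted triangle matrix with `D` atoms per plane give `2D`-atom dictionaries solving `(D_ε)`. -/
theorem triangle_planeLocal_dict : ∀ {t D : ℕ} {ε : ℝ} {C : Col t → Fin t → Fin t → ℝ} {U : Col t → Fin t → Fin D → ℝ} {W : Fin t → Fin D → Fin t → Fin t → ℝ}, PlaneFact ε C U W → ∀ {b₀ b₁ : Fin t}, b₀ ≠ b₁ → DictSolves ε (Sum.elim (W b₀) (W b₁) : Fin D ⊕ Fin D → Fin t → Fin t → ℝ) :=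
  fun hF _ _ hb => dictSolves_of_planeFact hF hb

end

end Summit.PneNP.PneNP.Theorems.XorDoor.TriLine
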